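import Mathlib.MeasureTheory.Integral.Prod
import Mathlib.MeasureTheory.Integral.IntegralEqImproper
import Mathlib.MeasureTheory.Function.L1Space.Integrable
import Mathlib.MeasureTheory.Measure.WithDensity
import Literature.Analysis.FluidPDE.ElgindiProfileNontrivial
import HarnessLib

/-!
# Tools for the `𝓗ᵏ` functional and the operator `L₁₂` on the quarter strip: domination of the
weighted `L²` terms, tails, and the linearity/integrability of `L₁₂` at `z = 0`

Topic `Literature/Analysis/FluidPDE`. Support file (everything proved, no named facts) of the
discharge plan of `Literature.Analysis.FluidPDE.Elgindi.ElgindiGhoulMasmoudi2021_stabilityNoSwirl`,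
serving the §2.6 datum fact `ElgindiGhoulMasmoudi2021_compactSupportDatum`
(`ElgindiStabilityDecomposition.lean`; Elgindi–Ghoul–Masmoudi, Camb. J. Math. 9 (2021),
arXiv:1910.14071, §2.6 p. 9, with the norms of §1.7 p. 6 and `L₁₂` of Def. 1.7 p. 6). The
`[0, ∞]`-valued functionals `Elgindi.eL2Sq`, `Elgindi.eHkNormSq` (`ElgindiWeightedSpaces.lean`) and
the iterated Bochner integral `Elgindi.L12` (`ElgindiFundamentalModel.lean`) are manipulated here
only through elementary measure theory:

* `eL2Sq` in `ofReal` form and **domination**: a pointwise bound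
  `g² ≤ C ∑ₖ Gₖ²` on the open strip gives `‖g‖² ≤ C ∑ₖ ‖Gₖ‖²` (`eL2Sq_le_of_sq_le_sum`);
* every term of `|f|²_{𝓗ᵏ}` is bounded by the whole functional, and conversely a uniform bound `B`
  on the terms bounds `|f|²_{𝓗ᵏ}` by `((k+1) + (k+1)²) B` (`eHkNormSq_le_of_forall_le`);
* **tails**: `tailSet M = strip ∩ {z ≥ M}`; if `∫⁻_{tailSet 1} G < ∞` then `∫⁻_{tailSet M} G → 0`,
  in the form "`≤ ε` for all `M ≥ M₀`" (`exists_lintegral_tailSet_le`; continuity from above of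
  the finite measure `G · vol|_{tailSet 1}`);
* **`L₁₂` at `0`**: for an integrand `f K/r` integrable on the strip, `L₁₂(f)(0)` is the integral
  over the strip (Fubini, `L12_zero_eq_setIntegral`), hence additive (`L12_zero_add`); it is
  homogeneous unconditionally (`L12_smul`); `|L₁₂(f)(0)| ≤ ∫⁻‖f K/r‖` (`abs_L12_zero_le`);
* **integrability of `f K/r` on the strip**: for `f` continuous on the strip with finite `𝓗⁰`
  functional (Cauchy–Schwarz against `K sin^{η/2}(2θ) z/(1+z)² ∈ L²`, the "trivial observation
  `|L₁₂(f)(0)| ≤ C|(z+1)f/z|_{L²}`" of Elgindi, Ann. of Math. 194 (2021), §9.3.1), and for the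
  explicit profile `F_*` (`F_* K/r = (4α/(1+z)²)(ΓK/c)`, no singularity).

Used from Mathlib: `MeasureTheory.integral_prod`, `Measure.prod_restrict`,
`MeasureTheory.MemLp.integrable_mul` (Hölder `2,2,1`), `tendsto_measure_iInter_atTop`,
`withDensity_apply`, `norm_integral_le_lintegral_norm`, `integrableOn_Ioi_deriv_of_nonneg'`,
`lintegral_prod_mul`.
-/

noncomputable section

open MeasureTheory Set Function Real Filter Finset
open _root_.Topology
open scoped ENNReal NNReal

namespace Literature.Analysis.FluidPDE

namespace Elgindi

/-! ### `eL2Sq` in `ofReal` form; domination -/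

/-- `eL2Sq g = ∫⁻_strip ofReal (g²)` (`‖x‖ₑ² = ofReal (x²)` for real `x`, as in
`FourierNS.enorm_sq_eq_ofReal_sq` of `NSFourierAPriori.lean`, not imported here). [folklore] -/
theorem eL2Sq_eq_lintegral_ofReal (g : ℝ → ℝ → ℝ) :
    eL2Sq g = ∫⁻ p in strip, ENNReal.ofReal ((g p.1 p.2) ^ 2) := by
  unfold eL2Sq
  refine lintegral_congr fun p => ?_
  rw [Real.enorm_eq_ofReal_abs, ← ENNReal.ofReal_pow (abs_nonneg _), sq_abs]

/-- `eL2Sq` only sees the values on the strip. [folklore] -/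
theorem eL2Sq_congr_strip {g₁ g₂ : ℝ → ℝ → ℝ} (h : ∀ p ∈ strip, g₁ p.1 p.2 = g₂ p.1 p.2) :
    eL2Sq g₁ = eL2Sq g₂ := by
  unfold eL2Sq
  exact setLIntegral_congr_fun measurableSet_strip fun p hp => by rw [h p hp]

/-- **Domination of the weighted `L²` functional**: if `g² ≤ C ∑ₖ Gₖ²` pointwise on the open
strip, with the `Gₖ` a.e.-measurable there, then `eL2Sq g ≤ C ∑ₖ eL2Sq Gₖ`. [folklore] -/
theorem eL2Sq_le_of_sq_le_sum {ι : Type*} (s : Finset ι) {g : ℝ → ℝ → ℝ} {G : ι → ℝ → ℝ → ℝ}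
    {C : ℝ} (hC : 0 ≤ C)
    (hG : ∀ k ∈ s, AEMeasurable (uncurry (G k)) (volume.restrict strip))
    (h : ∀ p ∈ strip, (g p.1 p.2) ^ 2 ≤ C * ∑ k ∈ s, (G k p.1 p.2) ^ 2) :
    eL2Sq g ≤ ENNReal.ofReal C * ∑ k ∈ s, eL2Sq (G k) := by
  rw [eL2Sq_eq_lintegral_ofReal]
  have hGm : ∀ k ∈ s, AEMeasurable (fun p : ℝ × ℝ => ENNReal.ofReal ((G k p.1 p.2) ^ 2))
      (volume.restrict strip) :=
    fun k hk => ((hG k hk).pow_const 2).ennreal_ofReal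
  calc ∫⁻ p in strip, ENNReal.ofReal ((g p.1 p.2) ^ 2)
      ≤ ∫⁻ p in strip, ENNReal.ofReal C * ∑ k ∈ s, ENNReal.ofReal ((G k p.1 p.2) ^ 2) := by
        refine setLIntegral_mono' measurableSet_strip fun p hp => ?_
        calc ENNReal.ofReal ((g p.1 p.2) ^ 2)
            ≤ ENNReal.ofReal (C * ∑ k ∈ s, (G k p.1 p.2) ^ 2) := ENNReal.ofReal_le_ofReal (h p hp)
          _ = ENNReal.ofReal C * ∑ k ∈ s, ENNReal.ofReal ((G k p.1 p.2) ^ 2) := by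
              rw [ENNReal.ofReal_mul hC, ENNReal.ofReal_sum_of_nonneg (fun k _ => sq_nonneg _)]
    _ = ENNReal.ofReal C * ∑ k ∈ s, ∫⁻ p in strip, ENNReal.ofReal ((G k p.1 p.2) ^ 2) := by
        rw [lintegral_const_mul'' _ (Finset.aemeasurable_sum s hGm |>.congr
          (Eventually.of_forall fun p => by simp [Finset.sum_apply])), lintegral_finsetSum' _ hGm]
    _ = ENNReal.ofReal C * ∑ k ∈ s, eL2Sq (G k) := by
        simp_rw [eL2Sq_eq_lintegral_ofReal]

/-- Binary domination: `g² ≤ A G₁² + B G₂²` on the strip gives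
`eL2Sq g ≤ A eL2Sq G₁ + B eL2Sq G₂`. [folklore] -/
theorem eL2Sq_le_of_sq_le_add {g G₁ G₂ : ℝ → ℝ → ℝ} {A B : ℝ} (hA : 0 ≤ A) (hB : 0 ≤ B)
    (hG₁ : AEMeasurable (uncurry G₁) (volume.restrict strip))
    (h : ∀ p ∈ strip, (g p.1 p.2) ^ 2 ≤ A * (G₁ p.1 p.2) ^ 2 + B * (G₂ p.1 p.2) ^ 2) :
    eL2Sq g ≤ ENNReal.ofReal A * eL2Sq G₁ + ENNReal.ofReal B * eL2Sq G₂ := by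
  rw [eL2Sq_eq_lintegral_ofReal, eL2Sq_eq_lintegral_ofReal, eL2Sq_eq_lintegral_ofReal]
  have h1m : AEMeasurable (fun p : ℝ × ℝ => ENNReal.ofReal A * ENNReal.ofReal ((G₁ p.1 p.2) ^ 2))
      (volume.restrict strip) :=
    ((hG₁.pow_const 2).ennreal_ofReal).const_mul _
  calc ∫⁻ p in strip, ENNReal.ofReal ((g p.1 p.2) ^ 2)
      ≤ ∫⁻ p in strip, (ENNReal.ofReal A * ENNReal.ofReal ((G₁ p.1 p.2) ^ 2) +
          ENNReal.ofReal B * ENNReal.ofReal ((G₂ p.1 p.2) ^ 2)) := by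
        refine setLIntegral_mono' measurableSet_strip fun p hp => ?_
        calc ENNReal.ofReal ((g p.1 p.2) ^ 2)
            ≤ ENNReal.ofReal (A * (G₁ p.1 p.2) ^ 2 + B * (G₂ p.1 p.2) ^ 2) :=
              ENNReal.ofReal_le_ofReal (h p hp)
          _ = _ := by
              rw [ENNReal.ofReal_add (by positivity) (by positivity), ENNReal.ofReal_mul hA,
                ENNReal.ofReal_mul hB]
    _ = ENNReal.ofReal A * (∫⁻ p in strip, ENNReal.ofReal ((G₁ p.1 p.2) ^ 2)) +
          ENNReal.ofReal B * (∫⁻ p in strip, ENNReal.ofReal ((G₂ p.1 p.2) ^ 2)) := by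
        rw [lintegral_add_left' h1m, lintegral_const_mul' _ _ ENNReal.ofReal_ne_top,
          lintegral_const_mul' _ _ ENNReal.ofReal_ne_top]

/-! ### Terms of the `𝓗ᵏ` functional versus the whole -/

/-- Each radial term is bounded by `|f|²_{𝓗ᵏ}` (`j ≤ k`). [folklore] -/
theorem eL2Sq_hkRadialTerm_le (α : ℝ) {k j : ℕ} (hj : j ≤ k) (f : ℝ → ℝ → ℝ) :
    eL2Sq (hkRadialTerm j f) ≤ eHkNormSq α k f := by
  unfold eHkNormSq
  refine le_trans ?_ le_self_add
  exact Finset.single_le_sum (f := fun j => eL2Sq (hkRadialTerm j f)) (fun _ _ => zero_le)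
    (mem_range.2 (by omega))

/-- Each mixed term is bounded by `|f|²_{𝓗ᵏ}` (`1 ≤ i`, `i + j ≤ k`). [folklore] -/
theorem eL2Sq_hkMixedTerm_le (α : ℝ) {k i j : ℕ} (hi : 1 ≤ i) (hij : i + j ≤ k) (f : ℝ → ℝ → ℝ) :
    eL2Sq (hkMixedTerm α i j f) ≤ eHkNormSq α k f := by
  unfold eHkNormSq
  refine le_trans ?_ le_add_self
  calc eL2Sq (hkMixedTerm α i j f)
      = if 1 ≤ i ∧ i + j ≤ k then eL2Sq (hkMixedTerm α i j f) else 0 := by rw [if_pos ⟨hi, hij⟩]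
    _ ≤ ∑ j' ∈ range (k + 1), if 1 ≤ i ∧ i + j' ≤ k then eL2Sq (hkMixedTerm α i j' f) else 0 :=
        Finset.single_le_sum (f := fun j' => if 1 ≤ i ∧ i + j' ≤ k then
          eL2Sq (hkMixedTerm α i j' f) else 0) (fun _ _ => zero_le) (mem_range.2 (by omega))
    _ ≤ ∑ i' ∈ range (k + 1), ∑ j' ∈ range (k + 1),
          if 1 ≤ i' ∧ i' + j' ≤ k then eL2Sq (hkMixedTerm α i' j' f) else 0 :=
        Finset.single_le_sum (f := fun i' => ∑ j' ∈ range (k + 1),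
          if 1 ≤ i' ∧ i' + j' ≤ k then eL2Sq (hkMixedTerm α i' j' f) else 0)
          (fun _ _ => zero_le) (mem_range.2 (by omega))

/-- **A uniform bound on the terms bounds the `𝓗ᵏ` functional**: if every radial term (`j ≤ k`)
and every mixed term (`1 ≤ i`, `i + j ≤ k`) has `eL2Sq ≤ B`, then
`|f|²_{𝓗ᵏ} ≤ ((k+1) + (k+1)²) B`. [folklore] -/
theorem eHkNormSq_le_of_forall_le {α : ℝ} {k : ℕ} {f : ℝ → ℝ → ℝ} {B : ℝ≥0∞}
    (hr : ∀ j, j ≤ k → eL2Sq (hkRadialTerm j f) ≤ B)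
    (hm : ∀ i j, 1 ≤ i → i + j ≤ k → eL2Sq (hkMixedTerm α i j f) ≤ B) :
    eHkNormSq α k f ≤ (((k + 1) + (k + 1) ^ 2 : ℕ) : ℝ≥0∞) * B := by
  unfold eHkNormSq
  have h1 : ∑ j ∈ range (k + 1), eL2Sq (hkRadialTerm j f) ≤ ((k + 1 : ℕ) : ℝ≥0∞) * B := by
    have := Finset.sum_le_card_nsmul (range (k + 1)) (fun j => eL2Sq (hkRadialTerm j f)) B
      (fun j hj => hr j (Nat.lt_succ_iff.mp (mem_range.mp hj)))
    simpa [nsmul_eq_mul] using this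
  have h2 : ∑ i ∈ range (k + 1), ∑ j ∈ range (k + 1),
      (if 1 ≤ i ∧ i + j ≤ k then eL2Sq (hkMixedTerm α i j f) else 0) ≤
        (((k + 1) ^ 2 : ℕ) : ℝ≥0∞) * B := by
    have hin : ∀ i ∈ range (k + 1), ∑ j ∈ range (k + 1),
        (if 1 ≤ i ∧ i + j ≤ k then eL2Sq (hkMixedTerm α i j f) else 0) ≤ ((k + 1 : ℕ) : ℝ≥0∞) * B := by
      intro i _
      have := Finset.sum_le_card_nsmul (range (k + 1))
        (fun j => if 1 ≤ i ∧ i + j ≤ k then eL2Sq (hkMixedTerm α i j f) else 0) B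
        (fun j _ => by
          split_ifs with hc
          · exact hm i j hc.1 hc.2
          · exact zero_le)
      simpa [nsmul_eq_mul] using this
    have := Finset.sum_le_card_nsmul (range (k + 1)) _ _ hin
    calc _ ≤ (range (k + 1)).card • (((k + 1 : ℕ) : ℝ≥0∞) * B) := this
      _ = (((k + 1) ^ 2 : ℕ) : ℝ≥0∞) * B := by
          rw [Finset.card_range, nsmul_eq_mul]
          push_cast
          ring
  calc _ ≤ ((k + 1 : ℕ) : ℝ≥0∞) * B + (((k + 1) ^ 2 : ℕ) : ℝ≥0∞) * B := add_le_add h1 h2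
    _ = _ := by push_cast; ring

/-- From a bound on the square to a bound on the norm: `|f|²_{𝓗ᵏ} ≤ ofReal (τ²)` with `τ > 0` and
strict inequality gives `|f|_{𝓗ᵏ} < ofReal τ`. [folklore] -/
theorem eHkNorm_lt_of_sq_lt {α : ℝ} {k : ℕ} {f : ℝ → ℝ → ℝ} {τ : ℝ} (hτ : 0 < τ)
    (h : eHkNormSq α k f < ENNReal.ofReal (τ ^ 2)) : eHkNorm α k f < ENNReal.ofReal τ := by
  unfold eHkNorm
  have e : ENNReal.ofReal τ = ENNReal.ofReal (τ ^ 2) ^ (1 / 2 : ℝ) := by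
    rw [ENNReal.ofReal_pow hτ.le, ← ENNReal.rpow_natCast, ← ENNReal.rpow_mul]
    norm_num
  rw [e]
  exact ENNReal.rpow_lt_rpow h (by norm_num)

/-! ### Tails in `z` -/

/-- The tail `strip ∩ {z ≥ M}` of the quarter strip. [folklore] -/
def tailSet (M : ℝ) : Set (ℝ × ℝ) := strip ∩ {p | M ≤ p.1}

/-- Tails are measurable. [folklore] -/
theorem measurableSet_tailSet (M : ℝ) : MeasurableSet (tailSet M) :=
  measurableSet_strip.inter (measurableSet_le measurable_const measurable_fst)

/-- Tails lie in the strip. [folklore] -/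
theorem tailSet_subset_strip (M : ℝ) : tailSet M ⊆ strip := inter_subset_left

/-- Tails decrease. [folklore] -/
theorem tailSet_mono {M M' : ℝ} (h : M ≤ M') : tailSet M' ⊆ tailSet M :=
  fun _ hp => ⟨hp.1, le_trans h hp.2⟩

/-- Membership in a tail. [folklore] -/
theorem mem_tailSet {M : ℝ} {p : ℝ × ℝ} : p ∈ tailSet M ↔ p ∈ strip ∧ M ≤ p.1 := Iff.rfl

/-- **Tails of a finite integral are small**: if `∫⁻_{tailSet 1} G < ∞` then for every `ε > 0`
there is `M₀ ≥ 1` with `∫⁻_{tailSet M} G ≤ ε` for all `M ≥ M₀` (continuity from above of the finite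
measure with density `G` on `tailSet 1`; the sets `{z ≥ n}` decrease to `∅`). [folklore] -/
theorem exists_lintegral_tailSet_le {G : ℝ × ℝ → ℝ≥0∞} (hG : ∫⁻ p in tailSet 1, G p ≠ ∞)
    {ε : ℝ≥0∞} (hε : 0 < ε) :
    ∃ M₀ : ℝ, 1 ≤ M₀ ∧ ∀ M, M₀ ≤ M → ∫⁻ p in tailSet M, G p ≤ ε := by
  set ν : Measure (ℝ × ℝ) := (volume.restrict (tailSet 1)).withDensity G with hν
  have hνM : ∀ M : ℝ, 1 ≤ M → ∫⁻ p in tailSet M, G p = ν {p | M ≤ p.1} := by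
    intro M hM
    have hset : {p : ℝ × ℝ | M ≤ p.1} ∩ tailSet 1 = tailSet M := by
      ext p
      simp only [mem_inter_iff, mem_setOf_eq, tailSet]
      constructor
      · rintro ⟨hM', hs, -⟩; exact ⟨hs, hM'⟩
      · rintro ⟨hs, hM'⟩; exact ⟨hM', hs, le_trans hM hM'⟩
    rw [hν, withDensity_apply _ (measurableSet_le measurable_const measurable_fst),
      Measure.restrict_restrict (measurableSet_le measurable_const measurable_fst), hset]
  have hs : ∀ n : ℕ, NullMeasurableSet {p : ℝ × ℝ | (n : ℝ) ≤ p.1} ν :=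
    fun n => (measurableSet_le measurable_const measurable_fst).nullMeasurableSet
  have hanti : Antitone fun n : ℕ => {p : ℝ × ℝ | (n : ℝ) ≤ p.1} := by
    intro n m hnm p hp
    simp only [mem_setOf_eq] at hp ⊢
    exact le_trans (Nat.cast_le.mpr hnm) hp
  have hfin : ∃ n : ℕ, ν {p : ℝ × ℝ | (n : ℝ) ≤ p.1} ≠ ∞ :=
    ⟨1, by rw [Nat.cast_one, ← hνM 1 le_rfl]; exact hG⟩
  have hlim := tendsto_measure_iInter_atTop hs hanti hfin
  have hempty : (⋂ n : ℕ, {p : ℝ × ℝ | (n : ℝ) ≤ p.1}) = ∅ := by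
    ext p
    simp only [mem_iInter, mem_setOf_eq, mem_empty_iff_false, iff_false, not_forall, not_le]
    exact exists_nat_gt p.1
  rw [hempty, measure_empty] at hlim
  obtain ⟨N, hN⟩ := eventually_atTop.1 (hlim.eventually (gt_mem_nhds hε))
  refine ⟨max (N : ℝ) 1, le_max_right _ _, fun M hM => ?_⟩
  have hM1 : 1 ≤ M := le_trans (le_max_right _ _) hM
  rw [hνM M hM1]
  calc ν {p | M ≤ p.1} ≤ ν {p | (N : ℝ) ≤ p.1} :=
        measure_mono fun p hp => le_trans (le_trans (le_max_left _ _) hM) hp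
    _ ≤ ε := (hN N le_rfl).le

/-- The integral over a tail is the integral over the strip of the function cut off to `{z ≥ M}`
(indicator form used with pointwise bounds). [folklore] -/
theorem lintegral_tailSet_eq_indicator (G : ℝ × ℝ → ℝ≥0∞) (M : ℝ) :
    ∫⁻ p in tailSet M, G p = ∫⁻ p in strip, ({p : ℝ × ℝ | M ≤ p.1}.indicator G) p := by
  rw [tailSet, inter_comm, ← Measure.restrict_restrict (measurableSet_le measurable_const
    measurable_fst), lintegral_indicator (measurableSet_le measurable_const measurable_fst)]

/-- A tail integral is at most the integral over the strip. [folklore] -/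
theorem lintegral_tailSet_le (G : ℝ × ℝ → ℝ≥0∞) (M : ℝ) :
    ∫⁻ p in tailSet M, G p ≤ ∫⁻ p in strip, G p :=
  lintegral_mono_set (tailSet_subset_strip M)

/-! ### `L₁₂` at `z = 0` as an integral over the strip -/

/-- The integrand `f(r, θ) K(θ)/r` of `L₁₂` as a function on `ℝ × ℝ`. [cite: ElgindiGhoulMasmoudi2021, Definition 1.7 (p. 6 of arXiv:1910.14071)] -/
def l12Integrand (f : ℝ → ℝ → ℝ) : ℝ × ℝ → ℝ :=
  fun p => f p.1 p.2 * kernelK p.2 / p.1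

/-- Unfolding `l12Integrand`. [folklore] -/
@[simp] theorem l12Integrand_apply (f : ℝ → ℝ → ℝ) (p : ℝ × ℝ) :
    l12Integrand f p = f p.1 p.2 * kernelK p.2 / p.1 := rfl

/-- Lebesgue measure on the strip is the product of the restricted one-dimensional measures. [folklore] -/
theorem volume_restrict_strip :
    (volume.restrict strip : Measure (ℝ × ℝ)) =
      (volume.restrict (Ioi (0 : ℝ))).prod (volume.restrict (Ioo 0 (π / 2))) := by
  rw [strip, Measure.volume_eq_prod, Measure.prod_restrict]

/-- **Fubini for `L₁₂(f)(0)`**: if `f K/r` is integrable on the strip then `L₁₂(f)(0)` is its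
integral over the strip. [folklore] -/
theorem L12_zero_eq_setIntegral {f : ℝ → ℝ → ℝ} (hf : IntegrableOn (l12Integrand f) strip) :
    L12 f 0 = ∫ p in strip, l12Integrand f p := by
  rw [L12_def]
  have hf' : Integrable (l12Integrand f)
      ((volume.restrict (Ioi (0 : ℝ))).prod (volume.restrict (Ioo 0 (π / 2)))) := by
    rw [← volume_restrict_strip]; exact hf
  have := integral_prod (l12Integrand f) hf'
  rw [← volume_restrict_strip] at this
  rw [this]
  rfl

/-- **Additivity of `L₁₂` at `0`** under integrability of both integrands. [folklore] -/
theorem L12_zero_add {f g : ℝ → ℝ → ℝ} (hf : IntegrableOn (l12Integrand f) strip)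
    (hg : IntegrableOn (l12Integrand g) strip) : L12 (f + g) 0 = L12 f 0 + L12 g 0 := by
  have e : l12Integrand (f + g) = fun p => l12Integrand f p + l12Integrand g p := by
    funext p; simp only [l12Integrand_apply, Pi.add_apply]; ring
  have hfg : IntegrableOn (l12Integrand (f + g)) strip := by rw [e]; exact hf.add hg
  rw [L12_zero_eq_setIntegral hf, L12_zero_eq_setIntegral hg, L12_zero_eq_setIntegral hfg,
    ← integral_add hf hg, e]

/-- **Homogeneity of `L₁₂`** (unconditional: Bochner integrals commute with scalars). [folklore] -/
theorem L12_smul (c : ℝ) (f : ℝ → ℝ → ℝ) (z : ℝ) : L12 (c • f) z = c * L12 f z := by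
  rw [L12_def, L12_def, ← integral_const_mul]
  congr 1
  funext r
  rw [← integral_const_mul]
  congr 1
  funext θ
  simp only [Pi.smul_apply, smul_eq_mul]
  ring

/-- `|L₁₂(f)(0)| ≤ ∫⁻_strip ‖f K/r‖` (as a real number), for an integrable integrand. [folklore] -/
theorem abs_L12_zero_le {f : ℝ → ℝ → ℝ} (hf : IntegrableOn (l12Integrand f) strip) :
    |L12 f 0| ≤ (∫⁻ p in strip, ‖l12Integrand f p‖ₑ).toReal := by
  rw [L12_zero_eq_setIntegral hf, ← Real.norm_eq_abs]
  refine (norm_integral_le_lintegral_norm _).trans (le_of_eq ?_)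
  congr 1
  exact lintegral_congr fun p => (ofReal_norm _)

/-! ### Integrability of `f K/r` on the strip -/

/-- `∫_0^∞ (1+z)⁻² dz` converges: `(1+z)⁻²` is integrable on `(0, ∞)`. [folklore] -/
theorem integrableOn_inv_one_add_sq : IntegrableOn (fun z : ℝ => ((1 + z) ^ 2)⁻¹) (Ioi 0) := by
  have hd : ∀ r ∈ Ici (0 : ℝ), HasDerivAt (fun r : ℝ => -(1 + r)⁻¹) (((1 + r) ^ 2)⁻¹) r := by
    intro r hr
    have hr1 : (1 + r) ≠ 0 := by
      have : (0 : ℝ) ≤ r := hr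
      positivity
    exact ((((hasDerivAt_id' r).const_add 1).fun_inv hr1).fun_neg).congr_deriv (by ring)
  have ht : Tendsto (fun r : ℝ => 1 + r) atTop atTop := tendsto_atTop_add_const_left _ 1 tendsto_id
  have h3 : Tendsto (fun r : ℝ => (1 + r)⁻¹) atTop (𝓝 0) := tendsto_inv_atTop_zero.comp ht
  have h4 : Tendsto (fun r : ℝ => -(1 + r)⁻¹) atTop (𝓝 0) := by simpa using h3.neg
  exact integrableOn_Ioi_deriv_of_nonneg' hd (fun r hr => by positivity) h4

/-- `∫⁻_0^∞ ofReal (C/(1+z)²) dz < ∞` for `C ≥ 0`. [folklore] -/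
theorem lintegral_Ioi_const_div_one_add_sq_lt_top {C : ℝ} (hC : 0 ≤ C) :
    ∫⁻ z in Ioi (0 : ℝ), ENNReal.ofReal (C / (1 + z) ^ 2) < ∞ := by
  have hi : IntegrableOn (fun z : ℝ => C / (1 + z) ^ 2) (Ioi 0) := by
    have h0 := integrableOn_inv_one_add_sq.const_mul C
    exact IntegrableOn.congr_fun (f := fun z : ℝ => C * ((1 + z) ^ 2)⁻¹) h0
      (fun z _ => by simp [div_eq_mul_inv]) measurableSet_Ioi
  rw [← ofReal_integral_eq_lintegral_ofReal hi (ae_of_all _ fun z => by positivity)]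
  exact ENNReal.ofReal_lt_top

/-- The strip measure of a function of `z` alone bounded by `ofReal (C/(1+z)²)`: the integral over
the strip is finite (`θ` ranges in an interval of length `π/2`). [folklore] -/
theorem lintegral_strip_lt_top_of_le_radial {G : ℝ × ℝ → ℝ≥0∞} {C : ℝ} (hC : 0 ≤ C)
    (h : ∀ p ∈ strip, G p ≤ ENNReal.ofReal (C / (1 + p.1) ^ 2)) : ∫⁻ p in strip, G p < ∞ := by
  calc ∫⁻ p in strip, G p ≤ ∫⁻ p in strip, ENNReal.ofReal (C / (1 + p.1) ^ 2) :=
        setLIntegral_mono' measurableSet_strip h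
    _ = (∫⁻ z in Ioi (0 : ℝ), ENNReal.ofReal (C / (1 + z) ^ 2)) *
          ∫⁻ _θ in Ioo (0 : ℝ) (π / 2), (1 : ℝ≥0∞) := by
        rw [volume_restrict_strip, ← lintegral_prod_mul (by fun_prop) (by fun_prop)]
        simp
    _ < ∞ := by
        simp only [setLIntegral_const, one_mul, Real.volume_Ioo]
        exact ENNReal.mul_lt_top (lintegral_Ioi_const_div_one_add_sq_lt_top hC)
          ENNReal.ofReal_lt_top

/-- `K = 3 sin θ cos²θ` is bounded by `3` in absolute value. [folklore] -/
theorem abs_kernelK_le (θ : ℝ) : |kernelK θ| ≤ 3 := by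
  unfold kernelK
  rw [abs_mul, abs_mul, abs_of_pos (by norm_num : (0 : ℝ) < 3)]
  have h1 : |Real.sin θ| ≤ 1 := Real.abs_sin_le_one θ
  have h2 : |Real.cos θ ^ 2| ≤ 1 := by
    rw [abs_of_nonneg (sq_nonneg _)]
    nlinarith [Real.cos_sq_le_one θ]
  nlinarith [abs_nonneg (Real.sin θ), abs_nonneg (Real.cos θ ^ 2)]

/-- The `𝓗⁰` weight is continuous on the open strip. [folklore] -/
theorem continuousOn_hWeight : ContinuousOn (fun p : ℝ × ℝ => hWeight p.1 p.2) strip := by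
  have h1 : ContinuousOn (fun p : ℝ × ℝ => radialWeight p.1) strip := by
    unfold radialWeight
    refine ContinuousOn.div (by fun_prop) (by fun_prop) fun p hp => ?_
    exact pow_ne_zero 2 (ne_of_gt hp.1)
  have h2 : ContinuousOn (fun p : ℝ × ℝ => Real.sin (2 * p.2) ^ (eta / 2)) strip :=
    ContinuousOn.rpow_const (by fun_prop) fun p _ => Or.inr (div_nonneg eta_pos.le zero_le_two)
  refine (h1.div h2 fun p hp => ?_).congr fun p _ => rfl
  have hs : 0 < Real.sin (2 * p.2) :=
    Real.sin_pos_of_pos_of_lt_pi (by linarith [hp.2.1]) (by linarith [hp.2.2])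
  exact (Real.rpow_pos_of_pos hs _).ne'

/-- The dual weight `K(θ)/(z · hWeight(z, θ))` is bounded by `3/(1+z)` on the strip
(`K ≤ 3`, `sin^{η/2}(2θ) ≤ 1`, `z/(1+z)² ≤ 1/(1+z)`). [folklore] -/
theorem abs_kernelK_div_mul_hWeight_le {p : ℝ × ℝ} (hp : p ∈ strip) :
    |kernelK p.2 / (p.1 * hWeight p.1 p.2)| ≤ 3 / (1 + p.1) := by
  obtain ⟨hz, hθ0, hθ1⟩ := hp
  have hz' : (0 : ℝ) < p.1 := hz
  have hs0 : 0 < Real.sin (2 * p.2) := Real.sin_pos_of_pos_of_lt_pi (by linarith) (by linarith)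
  have hs1 : Real.sin (2 * p.2) ^ (eta / 2) ≤ 1 :=
    Real.rpow_le_one hs0.le (Real.sin_le_one _) (div_nonneg eta_pos.le zero_le_two)
  have hspos : 0 < Real.sin (2 * p.2) ^ (eta / 2) := Real.rpow_pos_of_pos hs0 _
  have e : kernelK p.2 / (p.1 * hWeight p.1 p.2) =
      kernelK p.2 * Real.sin (2 * p.2) ^ (eta / 2) * (p.1 / (1 + p.1) ^ 2) := by
    unfold hWeight radialWeight
    field_simp
  rw [e, abs_mul, abs_mul, abs_of_pos hspos,
    abs_of_pos (show 0 < p.1 / (1 + p.1) ^ 2 by positivity)]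
  have hK := abs_kernelK_le p.2
  have hr : p.1 / (1 + p.1) ^ 2 ≤ 1 / (1 + p.1) := by
    rw [div_le_div_iff₀ (by positivity) (by positivity)]
    nlinarith
  calc |kernelK p.2| * Real.sin (2 * p.2) ^ (eta / 2) * (p.1 / (1 + p.1) ^ 2)
      ≤ 3 * 1 * (1 / (1 + p.1)) := by
        apply mul_le_mul (mul_le_mul hK hs1 hspos.le (by norm_num)) hr (by positivity)
          (by norm_num)
    _ = 3 / (1 + p.1) := by ring

/-- **`f K/r` is integrable on the strip when `f` is continuous there with finite `𝓗⁰`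
functional** (Cauchy–Schwarz: `f·hWeight ∈ L²(strip)` against `K/(z·hWeight) ∈ L²(strip)`; the
"trivial observation `|L₁₂(f)(0)| ≤ C|(z+1)f/z|_{L²}`" of Elgindi 2021, §9.3.1). [cite: Elgindi2021, §9.3.1 (p. 33 of arXiv:1904.04795): |L₁₂(f)(0)| ≤ C|(z+1)f/z|_{L²}] -/
theorem integrableOn_l12Integrand_of_eL2Sq {f : ℝ → ℝ → ℝ} (hc : ContinuousOn (uncurry f) strip)
    (hfin : eL2Sq (hkRadialTerm 0 f) ≠ ∞) : IntegrableOn (l12Integrand f) strip := by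
  set f₁ : ℝ × ℝ → ℝ := fun p => f p.1 p.2 * hWeight p.1 p.2 with hf₁
  set f₂ : ℝ × ℝ → ℝ := fun p => kernelK p.2 / (p.1 * hWeight p.1 p.2) with hf₂
  have hf₁c : ContinuousOn f₁ strip := hc.mul continuousOn_hWeight
  have hf₂c : ContinuousOn f₂ strip := by
    refine ContinuousOn.div (continuous_kernelK.comp_continuousOn continuousOn_snd)
      (continuousOn_fst.mul continuousOn_hWeight) fun p hp => ?_
    exact mul_ne_zero (ne_of_gt hp.1) (by linarith [one_le_hWeight hp])
  have h1 : MemLp f₁ 2 (volume.restrict strip) := by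
    refine ⟨hf₁c.aestronglyMeasurable measurableSet_strip, ?_⟩
    rw [eLpNorm_eq_lintegral_rpow_enorm_toReal two_ne_zero ENNReal.ofNat_ne_top]
    simp only [ENNReal.toReal_ofNat, one_div]
    refine ENNReal.rpow_lt_top_of_nonneg (by norm_num) ?_
    have e : ∫⁻ p in strip, ‖f₁ p‖ₑ ^ (2 : ℝ) = eL2Sq (hkRadialTerm 0 f) := by
      simp [eL2Sq, hkRadialTerm, hf₁]
    rw [e]
    exact hfin
  have h2 : MemLp f₂ 2 (volume.restrict strip) := by
    refine ⟨hf₂c.aestronglyMeasurable measurableSet_strip, ?_⟩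
    rw [eLpNorm_eq_lintegral_rpow_enorm_toReal two_ne_zero ENNReal.ofNat_ne_top]
    simp only [ENNReal.toReal_ofNat, one_div]
    refine ENNReal.rpow_lt_top_of_nonneg (by norm_num) (ne_of_lt ?_)
    refine lintegral_strip_lt_top_of_le_radial (C := 9) (by norm_num) fun p hp => ?_
    have hb := abs_kernelK_div_mul_hWeight_le hp
    have hz : (0 : ℝ) < p.1 := hp.1
    rw [ENNReal.rpow_two, Real.enorm_eq_ofReal_abs, ← ENNReal.ofReal_pow (abs_nonneg _), sq_abs]
    refine ENNReal.ofReal_le_ofReal ?_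
    have h3 : 0 ≤ 3 / (1 + p.1) := by positivity
    calc f₂ p ^ 2 = |f₂ p| ^ 2 := (sq_abs _).symm
      _ ≤ (3 / (1 + p.1)) ^ 2 := pow_le_pow_left₀ (abs_nonneg _) hb 2
      _ = 9 / (1 + p.1) ^ 2 := by field_simp; norm_num
  have h12 : Integrable (f₁ * f₂) (volume.restrict strip) := h1.integrable_mul h2
  refine IntegrableOn.congr_fun h12 (fun p hp => ?_) measurableSet_strip
  have hW : hWeight p.1 p.2 ≠ 0 := by linarith [one_le_hWeight hp]
  have hz : p.1 ≠ 0 := ne_of_gt hp.1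
  simp only [Pi.mul_apply, hf₁, hf₂, l12Integrand_apply]
  field_simp

/-- **`F_* K/r` is integrable on the strip**: `F_*(z,θ)K(θ)/z = (4α/(1+z)²)·(Γ(θ)K(θ)/c)`, the
product of an integrable function of `z` and a continuous function of `θ` (`α ≥ 0`). [folklore] -/
theorem integrableOn_l12Integrand_fundamentalProfile {α : ℝ} (hα : 0 ≤ α) :
    IntegrableOn (l12Integrand (fundamentalProfile α)) strip := by
  have h1 : Integrable (fun z : ℝ => 4 * α * ((1 + z) ^ 2)⁻¹) (volume.restrict (Ioi 0)) :=
    integrableOn_inv_one_add_sq.const_mul (4 * α)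
  have h2 : Integrable (fun θ : ℝ => kernelK θ * angularWeight α θ / profileConst α)
      (volume.restrict (Ioo 0 (π / 2))) := by
    have hc : Continuous fun θ : ℝ => kernelK θ * angularWeight α θ / profileConst α :=
      (continuous_kernelK_mul_angularWeight hα).div_const _
    exact (hc.integrableOn_Icc (a := 0) (b := π / 2)).mono_set Ioo_subset_Icc_self
  have h12 := h1.mul_prod h2
  rw [← volume_restrict_strip] at h12
  refine IntegrableOn.congr_fun h12 (fun p hp => ?_) measurableSet_strip
  have hz : p.1 ≠ 0 := ne_of_gt hp.1
  have hz1 : 1 + p.1 ≠ 0 := by have : (0 : ℝ) < p.1 := hp.1; positivity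
  simp only [l12Integrand_apply, fundamentalProfile]
  field_simp

/-- A bounded continuous radial factor keeps integrability of the `L₁₂` integrand on the strip. [folklore] -/
theorem integrableOn_l12Integrand_radialMul {c : ℝ → ℝ} {f : ℝ → ℝ → ℝ} {C : ℝ} (hc : Continuous c)
    (hcb : ∀ z, |c z| ≤ C) (hf : IntegrableOn (l12Integrand f) strip) :
    IntegrableOn (l12Integrand (fun z θ => c z * f z θ)) strip := by
  have h := Integrable.bdd_mul hf ((hc.comp continuous_fst).aestronglyMeasurable)
    (ae_of_all _ fun p => (Real.norm_eq_abs _).le.trans (hcb p.1))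
  refine IntegrableOn.congr_fun h (fun p _ => ?_) measurableSet_strip
  simp only [l12Integrand_apply, comp_apply]
  ring

end Elgindi

end Literature.Analysis.FluidPDE
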